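import Mathlib

/-!
# T6N41Datum — the global doubling L-function datum of N4.1 (Tier 6, second assignment of t6-p4; M2)

Record formalised: TIER5 §N4.1 = route/T5-N4.1-route-1.md v6.7 (THEOREM N4.1 (a)–(d), steps (P0)–(P7)); kernel
shape per the lead's M2 word (TARGET-T6 v0.4 §9.4, STATUS l. 4691): ONE datum per owner (R6), the global
L-function `L(s, π × χ_V)` is ONE field `L : ℂ → ℂ`, the local Lapid–Rallis factors `Lv` are fields because the
consumed displays quantify over places (the zero-free shapes of (P2) at `v ∈ S`, the unramified identity of
(P3)+(P7) at `v ∉ S`), the Hecke L-functions `L_fin(s, η_i′)` are fields with Iwasawa's theorems displayed ON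
them, and `(H_loc)` is the Prop `Hloc` — at composition consumed as `N42_main ∧ N43_main` BY NAME through the
lead's `NAut` compatibility fields (§9.2(b)).

The datum is for ONE irreducible cuspidal automorphic representation `π` of `U(W)(𝔸_F)` (side A: `π₀`; side B:
`π₀′` — two instances of the same type, `N4_main : M.iA ∧ M.iB` applies `N41_main` twice) over an abstract
index type `ι` of places of `F`.  Fields are DATA (or opaque Props naming a printed hypothesis); the printed
theorems about them are the displays of `T6N41Hyp.lean`, consumed by name in `T6N41Main.lean`; the
order-of-vanishing mathematics is `T6N41Core` / `T6N41Glue` / `T6N41Euler` / `T6N41Shapes` (carrier-free).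

§8(d): uses an L-value-free non-vanishing device: NO (the datum carries the L-value of the record).
-/

namespace Summit.Ventures.HodgeRepro2.T6

/-- The global doubling L-function datum of N4.1 for one cuspidal `π` of `U(W)(𝔸_F)` (`dim_E W = 2`), the
`3`-dimensional hermitian space `V` and its splitting character `χ_V` of the route (TIER5 (N0.3), N4.1 (N4.1.1)),
over an abstract type `ι` of places of `F`.  Fields are the objects the printed theorems of N4.1 speak about:
* `S` — the finite set of places of (N4.1.1)(d): the archimedean places and every place where `E/F`, `W`, `V`,
  `V′`, `ψ`, `χ_V`, `χ_{V′}`, `χ_W` or `β′` is ramified (T3 col. 4);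
* `Lv v` — `s ↦ L(s, π_v × χ_{V,v})`, the local Lapid–Rallis doubling factor at `v` (GQT §11.6 «Lapid-Rallis
  has defined the standard L-factors L(s, π_v × χ_{V,v})»; the function of `s`, with the convention that a
  pole of the printed factor is a zero of the function, as Mathlib's `Complex.Gamma`);
* `L` — `s ↦ L(s, π × χ_V)`, the global doubling L-function (the Euler product of the `Lv` for `Re s ≫ 0`
  and its meromorphic continuation, Lapid–Rallis Thm 4 — displayed);
* `thetaNonzero v` — the hypothesis «the local theta lift `Θ_{V_v}(π_v)` is nonzero» of GQT Thm 11.4(ii) at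
  the place `v` (`(H_loc)` at `v`; an opaque Prop, identified with `N42_main` / `N43_main` at composition);
* `L₁`, `L₂` — `s ↦ L_fin(s, η_i′)`, Iwasawa's Hecke L-functions of the two unitary Hecke characters `η₁′`,
  `η₂′` of `E` of (N4.1.1)(b)/(d) (Iwasawa 2019 ch. 3; displayed: meromorphic, simple pole at `1` iff
  `η ≡ 1`, non-zero at `1` otherwise);
* `g₁ v`, `g₂ v` — the Euler factor of `L_fin(s, η_i′)` at `v`: `(1 − η_i′(ϖ_v) q_v^{−s})⁻¹` at a finite
  place where `η_i′` is unramified, `1` at a ramified finite place and at an archimedean place (Iwasawa's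
  definition of `L(s;χ)`; displayed);
* `triv₁`, `triv₂` — the Props «`η_i′ ≡ 1`» (Iwasawa's case distinction in Thm 3.1). -/
structure DoublingLDatum (ι : Type*) where
  /-- the finite set `S` of places of (N4.1.1)(d) / T3 col. 4 -/
  S : Finset ι
  /-- `s ↦ L(s, π_v × χ_{V,v})`, the Lapid–Rallis local factor at the place `v` -/
  Lv : ι → ℂ → ℂ
  /-- `s ↦ L(s, π × χ_V)`, the global doubling L-function -/
  L : ℂ → ℂ
  /-- «the local theta lift `Θ_{V_v}(π_v)` is nonzero» at `v` — `(H_loc)` at `v` -/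
  thetaNonzero : ι → Prop
  /-- `s ↦ L_fin(s, η₁′)`, Iwasawa's L-function of the Hecke character `η₁′` -/
  L₁ : ℂ → ℂ
  /-- `s ↦ L_fin(s, η₂′)`, Iwasawa's L-function of the Hecke character `η₂′` -/
  L₂ : ℂ → ℂ
  /-- the Euler factor of `L_fin(s, η₁′)` at `v` (`1` at archimedean and ramified places) -/
  g₁ : ι → ℂ → ℂ
  /-- the Euler factor of `L_fin(s, η₂′)` at `v` (`1` at archimedean and ramified places) -/
  g₂ : ι → ℂ → ℂ
  /-- «`η₁′ ≡ 1`» -/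
  triv₁ : Prop
  /-- «`η₂′ ≡ 1`» -/
  triv₂ : Prop

namespace DoublingLDatum

variable {ι : Type*}

/-- [definition: `(H_loc)` of THEOREM N4.1 — «for every place `v` of `F` the local theta lift `Θ_{V_v}(π_v)` of
`π_v` to `U(V_v)` is non-zero» — as the conjunction over all places of the datum's `thetaNonzero`.] -/
def Hloc (D : DoublingLDatum ι) : Prop :=
  ∀ v, D.thetaNonzero v

/-- [definition: `(R1)` = THEOREM N4.1 (a)+(b) — «`L(s, π × χ_V)` is holomorphic at `s = 1`» and
«`L(1, π × χ_V) ≠ 0`» — in the interface's words: `L` is analytic at `1` and its value at `1` is non-zero; the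
conclusion of `N41_main`.] -/
def R1 (D : DoublingLDatum ι) : Prop :=
  AnalyticAt ℂ D.L 1 ∧ D.L 1 ≠ 0

/-- [definition: the by-product of (P4) — «both characters are non-trivial», `η₁′ ≢ 1` and `η₂′ ≢ 1`.] -/
def BothNontrivial (D : DoublingLDatum ι) : Prop :=
  ¬ D.triv₁ ∧ ¬ D.triv₂

/-- The `S`-part `L_S(s) = ∏_{v ∈ S} L(s, π_v × χ_{V,v})` of (P0), as a function of `s`. -/
noncomputable def LS (D : DoublingLDatum ι) : ℂ → ℂ :=
  ∏ v ∈ D.S, D.Lv v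

/-- `LS` evaluated. -/
theorem LS_apply (D : DoublingLDatum ι) (s : ℂ) : D.LS s = ∏ v ∈ D.S, D.Lv v s := by
  simp [LS]

end DoublingLDatum

end Summit.Ventures.HodgeRepro2.T6
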